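import Mathlib
import Literature.NumberTheory.GaloisRepresentations.AbsGaloisOuterConj
import Literature.NumberTheory.GaloisRepresentations.SatakeFamilyOfFramedGaloisRep
import Literature.NumberTheory.GaloisRepresentations.HeckeCharacterGaloisAvatarProofs
import Literature.NumberTheory.GaloisRepresentations.HeckeCharacterOfRayClass
import Literature.NumberTheory.GaloisRepresentations.FramedRepTwist
import Literature.NumberTheory.Automorphic.SelfdualGL3AdjointLiftProofs
import Literature.NumberTheory.Automorphic.AutomorphicRepsGLSatakeFlathProofs
import Literature.NumberTheory.Automorphic.ChebotarevArtinRepHolds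
import Summits.Langlands.Langlands.Theorems.TwistUnpackaging.Negative.TwistSeparationOrder
import Literature.NumberTheory.NumberFields.ThainePrimes
import Literature.NumberTheory.NumberFields.UnitsPrimePowerGensIndepModPowers
import Literature.NumberTheory.LFunctions.PowerResidueRayClassCharacter

/-!
# A separating ray class twist of odd prime exponent — stub `stub_rayClassTwist` of line kummer-chebotarev-separating-twists (crux TwistUnpackaging, stmt-Langlands-10903)

For a quadratic extension of number fields `F/F₀` with non-trivial automorphism `τ`, a finite
set `S` of places of `F`, a finite batch `T` of places `w` with `τ • w ≠ w` and a bound `m`, we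
produce a prime `p > max(m, 2)`, ONE auxiliary prime `𝔮 ∉ S ∪ T ∪ τT` of `F` and a ray class
character `ψ` modulo `𝔮` (`Literature.NumberTheory.LFunctions.IsRayClassCharacter`, Neukirch
VII (6.8)) of exponent `p` off `𝔮` which **separates** the batch: `ψ(τ • w) ≠ ψ(w)` for all
`w ∈ T` (`stub_rayClassTwist`).

Construction (Kummer theory + Chebotarev, in the form of the tree's Thaine-prime theorem
`Literature.NumberTheory.NumberFields.exists_prime_classGroup_kummer`, [Schoof2009, Lemma 16.2]):

1. `h ≥ 1` with every `𝔭^h = (g_𝔭)` principal; a prime `p > m + h + w_F + #P + 2`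
   (`P = T ∪ τT`, `w_F` = number of roots of unity of `F`), so `p ∤ h`, `p ∤ w_F`, `#P < p` and
   `F` has no primitive `p`-th root of unity.
2. The family `b = (ε₁, …, ε_r, g_v (v ∈ P))` (fundamental units and the generators at the
   batch) is independent modulo `p`-th powers
   (`Literature.NumberTheory.NumberFields.indepModPowers_fundSystem_append`).
3. Thaine/Chebotarev gives a degree-one prime `𝔮 ∉ S ∪ P`, `N𝔮 = l`, `p ∣ l - 1`, and `z` of
   order `p` modulo `𝔮` with `ε_i^{(l-1)/p} ≡ 1` and `g_{v_j}^{(l-1)/p} ≡ z^j (mod 𝔮)` for the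
   `j`-th place `v_j` of `P` — i.e. a prescribed Frobenius in `F(ζ_p, b^{1/p})/F`.
4. With a multiplicative character `χ` of `𝓞 F/𝔮` non-trivial at `z̄` (Mathlib
   `MulChar.exists_apply_ne_one_of_hasEnoughRootsOfUnity`) and `hh' ≡ 1 (mod p)`, the character
   `ψ(𝔭) = χ(ḡ_𝔭)^{(l-1)/p · h'}` (the `p`-th power residue symbol at `𝔮`, made into a character
   of ideals) is a ray class character modulo `𝔮`
   (`Literature.NumberTheory.LFunctions.isRayClassCharacter_powResidue`, the units being killed
   by `forall_units_powResidue_eq_one`), `ψ(𝔭)^p = 1` for `𝔭 ≠ 𝔮`, and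
   `ψ(v_j) = χ(z̄)^{j h'}` with `χ(z̄)` a primitive `p`-th root of unity: distinct places of `P`
   get distinct values since `#P < p`, in particular `ψ(τ • w) ≠ ψ(w)`.

The hypotheses `[F : F₀] = 2` and `τ ≠ 1` of the registered signature are not needed for this
statement (only `τ • w ≠ w` on `T` is).

## References

* R. Schoof, *Catalan's Conjecture*, Universitext, Springer 2009, Lemma 16.2. [Schoof2009]
* L. C. Washington, *Introduction to Cyclotomic Fields*, GTM 83, Springer 1997, §15.2. [Washington1997]
* J. Neukirch, *Algebraic Number Theory*, Springer 1999, Ch. V §3, Ch. VII (6.8). [NeukirchANT1999]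
-/

set_option linter.dupNamespace false -- project-wide option (lakefile weak.linter.dupNamespace); `Summit.Langlands.Langlands` is the mandated namespace

open Literature.NumberTheory.GaloisRepresentations Literature.NumberTheory.Automorphic
open IsDedekindDomain NumberField Filter
open NumberField.Units Literature.NumberTheory.NumberFields Literature.NumberTheory.LFunctions
  Literature.FieldTheory.Kummer

namespace Summit.Langlands.Langlands.Theorems.TwistUnpackaging.KummerChebotarev

/-- **A separating ray class twist of odd prime exponent.**  For `F/F₀` with an automorphism
`τ`, a finite set `S` of places, a finite batch `T` of `τ`-moved places and a bound `m`, there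
are a prime `p > max(m, 2)`, a prime `𝔮 ∉ S` of `F` different from `w` and `τ • w` for all
`w ∈ T`, and a ray class character `ψ` modulo `𝔮` with `ψ(v)^p = 1` for `v ≠ 𝔮` and
`ψ(τ • w) ≠ ψ(w)` for all `w ∈ T`.  Proof: Thaine primes for the Kummer family (fundamental
units, generators of `v^h`, `v ∈ T ∪ τT`) and the `p`-th power residue character at the
resulting prime `𝔮`, see the module docstring (Schoof, *Catalan's Conjecture*, Lemma 16.2;
Washington, *Cyclotomic Fields*, §15.2; Neukirch VII (6.8)). -/
theorem stub_rayClassTwist :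
    ∀ (F₀ F : Type) [Field F₀] [NumberField F₀] [Field F] [NumberField F] [Algebra F₀ F]
      (τ : F ≃ₐ[F₀] F), Module.finrank F₀ F = 2 → τ ≠ 1 →
    ∀ (S : Set (HeightOneSpectrum (𝓞 F))) (T : Finset (HeightOneSpectrum (𝓞 F))) (m : ℕ),
      S.Finite → (∀ w ∈ T, τ • w ≠ w) →
    ∃ (p : ℕ) (𝔮 : HeightOneSpectrum (𝓞 F)) (ψ : HeightOneSpectrum (𝓞 F) → ℂ),
      p.Prime ∧ m < p ∧ 2 < p ∧
      Literature.NumberTheory.LFunctions.IsRayClassCharacter 𝔮.asIdeal ψ ∧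
      𝔮 ∉ S ∧ (∀ w ∈ T, w ≠ 𝔮 ∧ τ • w ≠ 𝔮) ∧
      (∀ v : HeightOneSpectrum (𝓞 F), v ≠ 𝔮 → ψ v ^ p = 1) ∧
      (∀ w ∈ T, ψ (τ • w) ≠ ψ w) := by
  intro F₀ F _ _ _ _ _ τ _ _ S T m hS hT
  classical
  -- ### 1. constants: `h`, the generators `G v` of `v ^ h`, the batch `P = T ∪ τT`, the prime `p`
  obtain ⟨h, hh0, hGex⟩ := exists_forall_span_singleton_eq_pow F
  choose G hG using hGex
  set P : Finset (HeightOneSpectrum (𝓞 F)) := T ∪ T.image (fun w => τ • w) with hPdef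
  have hTP : ∀ w ∈ T, w ∈ P ∧ τ • w ∈ P := fun w hw =>
    ⟨Finset.mem_union_left _ hw, Finset.mem_union_right _ (Finset.mem_image_of_mem _ hw)⟩
  obtain ⟨p, hple, hp⟩ := Nat.exists_infinite_primes (m + h + torsionOrder F + P.card + 3)
  have hmp : m < p := by omega
  have h2p : 2 < p := by omega
  have hsp : P.card < p := by omega
  have hph : ¬ p ∣ h := fun hd => by
    have := Nat.le_of_dvd hh0 hd
    omega
  have hpt : ¬ p ∣ torsionOrder F := fun hd => by
    have := Nat.le_of_dvd (torsionOrder_pos F) hd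
    omega
  haveI := Fact.mk hp
  have hcopph : p.Coprime h := (Nat.Prime.coprime_iff_not_dvd hp).mpr hph
  have hζF : ∀ ξ : F, ¬ IsPrimitiveRoot ξ p := fun ξ hξ =>
    hpt (dvd_torsionOrder_of_isPrimitiveRoot hξ)
  -- ### 2. the Kummer family: fundamental units and the generators at the batch
  set enum : Fin P.card → HeightOneSpectrum (𝓞 F) :=
    fun j => ((P.equivFin.symm j : P) : HeightOneSpectrum (𝓞 F)) with henum
  have henum_inj : Function.Injective enum :=
    Subtype.val_injective.comp P.equivFin.symm.injective
  have henum_apply : ∀ (w) (hw : w ∈ P), enum (P.equivFin ⟨w, hw⟩) = w := fun w hw => by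
    simp only [henum, Equiv.symm_apply_apply]
  set b : Fin (rank F + P.card) → 𝓞 F :=
    Fin.append (fun i => ((fundSystem F i : (𝓞 F)ˣ) : 𝓞 F)) (fun j => G (enum j)) with hb
  have hb0 : ∀ i, b i ≠ 0 := fundSystem_append_ne_zero (fun j => hG (enum j))
  have hind : IndepModPowers p (fun i => (b i : F)) :=
    indepModPowers_fundSystem_append hp.pos hcopph henum_inj (fun j => hG (enum j))
  set mv : Fin (rank F + P.card) → ZMod p :=
    Fin.append (fun _ => 0) (fun j => ((j : ℕ) : ZMod p)) with hmv
  -- ### 3. the Thaine prime `𝔮` and the element `z` of order `p` modulo `𝔮`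
  obtain ⟨𝔮, h𝔮S, -, hpl, -, z, hz1, hz2, hz3⟩ :=
    exists_prime_classGroup_kummer hζF b hb0 hind mv 1 (S ∪ ↑P) (hS.union P.finite_toSet)
  simp only [Set.mem_union, Finset.mem_coe, not_or] at h𝔮S
  obtain ⟨h𝔮S, h𝔮P⟩ := h𝔮S
  haveI : 𝔮.asIdeal.IsMaximal := 𝔮.isMaximal
  have hfund : ∀ i, ((fundSystem F i : (𝓞 F)ˣ) : 𝓞 F) ^ ((Ideal.absNorm 𝔮.asIdeal - 1) / p) - 1 ∈
      𝔮.asIdeal := fun i => by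
    have h1 := hz3 (Fin.castAdd P.card i)
    simp only [hb, hmv, Fin.append_left, ZMod.val_zero, pow_zero] at h1
    exact h1
  have hgen : ∀ j : Fin P.card,
      Ideal.Quotient.mk 𝔮.asIdeal (G (enum j)) ^ ((Ideal.absNorm 𝔮.asIdeal - 1) / p) =
        Ideal.Quotient.mk 𝔮.asIdeal z ^ (j : ℕ) := fun j => by
    have h1 := hz3 (Fin.natAdd (rank F) j)
    simp only [hb, hmv, Fin.append_right] at h1
    rw [ZMod.val_natCast, Nat.mod_eq_of_lt (j.2.trans hsp)] at h1
    rw [← map_pow, ← map_pow]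
    exact Ideal.Quotient.eq.mpr h1
  have hz1' : Ideal.Quotient.mk 𝔮.asIdeal z ≠ 1 := fun h1 =>
    hz2 (Ideal.Quotient.eq.mp (by rw [h1, map_one]))
  have hzp : Ideal.Quotient.mk 𝔮.asIdeal z ^ p = 1 := by
    have h1 := Ideal.Quotient.eq.mpr hz1
    rwa [map_pow, map_one] at h1
  -- ### 4. the character
  haveI : NeZero ((Monoid.exponent (𝓞 F ⧸ 𝔮.asIdeal)ˣ : ℕ) : ℂ) :=
    ⟨Nat.cast_ne_zero.mpr Monoid.exponent_ne_zero_of_finite⟩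
  obtain ⟨χ, hχ⟩ :=
    MulChar.exists_apply_ne_one_of_hasEnoughRootsOfUnity (𝓞 F ⧸ 𝔮.asIdeal) ℂ hz1'
  have hωp : χ (Ideal.Quotient.mk 𝔮.asIdeal z) ^ p = 1 := by rw [← map_pow, hzp, map_one]
  have hord : orderOf (χ (Ideal.Quotient.mk 𝔮.asIdeal z)) = p := orderOf_eq_prime hωp hχ
  obtain ⟨h', -, hh'⟩ := Nat.exists_mul_mod_eq_one_of_coprime hcopph.symm hp.one_lt
  have hh'p : ¬ p ∣ h' := fun hd => by
    have := Nat.mod_eq_zero_of_dvd (dvd_mul_of_dvd_right hd h)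
    omega
  have hunit := forall_units_powResidue_eq_one 𝔮 hp hpl hpt χ hfund
  have hval : ∀ (v) (hv : v ∈ P),
      χ (Ideal.Quotient.mk 𝔮.asIdeal (G v)) ^ ((Ideal.absNorm 𝔮.asIdeal - 1) / p * h') =
        χ (Ideal.Quotient.mk 𝔮.asIdeal z) ^ (((P.equivFin ⟨v, hv⟩ : Fin P.card) : ℕ) * h') :=
    fun v hv => by
    conv_lhs => rw [← henum_apply v hv]
    rw [pow_mul, ← map_pow, hgen, map_pow, ← pow_mul]
  refine ⟨p, 𝔮, fun v => χ (Ideal.Quotient.mk 𝔮.asIdeal (G v)) ^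
      ((Ideal.absNorm 𝔮.asIdeal - 1) / p * h'), hp, hmp, h2p,
    isRayClassCharacter_powResidue 𝔮 χ hpl hh' hG hunit, h𝔮S, fun w hw => ?_,
    fun v hv => powResidue_pow_eq_one 𝔮 χ hpl hG hv, fun w hw heq => ?_⟩
  · exact ⟨fun h1 => h𝔮P (h1 ▸ (hTP w hw).1), fun h1 => h𝔮P (h1 ▸ (hTP w hw).2)⟩
  · -- separation: `ψ(τ • w) = ω^{j₂ h'} ≠ ω^{j₁ h'} = ψ(w)` since `j₂ ≠ j₁ < p` and `p ∤ h'`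
    obtain ⟨hwP, hτwP⟩ := hTP w hw
    dsimp only at heq
    have hfin : IsOfFinOrder (χ (Ideal.Quotient.mk 𝔮.asIdeal z)) :=
      isOfFinOrder_iff_pow_eq_one.mpr ⟨p, hp.pos, hωp⟩
    rw [hval _ hτwP, hval _ hwP, hfin.pow_eq_pow_iff_modEq, hord] at heq
    have hcop' : p.gcd h' = 1 := (Nat.Prime.coprime_iff_not_dvd hp).mpr hh'p
    have hjj := Nat.ModEq.eq_of_lt_of_lt (Nat.ModEq.cancel_right_of_coprime hcop' heq)
      ((P.equivFin ⟨τ • w, hτwP⟩).2.trans hsp) ((P.equivFin ⟨w, hwP⟩).2.trans hsp)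
    have h1 := P.equivFin.injective (Fin.ext hjj)
    exact hT w hw (congrArg Subtype.val h1)

end Summit.Langlands.Langlands.Theorems.TwistUnpackaging.KummerChebotarev
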